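import Literature.MathematicalPhysics.QuantumFieldTheory.Balaban1983to89.B13LocEAnalytic
import Literature.MathematicalPhysics.QuantumFieldTheory.Balaban1983to89.Beta.RemainderChainLattice

/-!
# ROAD P3 — socket S4 (`hdiff`, [I] (4.4) in holomorphic currency) FROM THE ACTIVITIES:
# Lemma 3 (2.38) + the Kotecký–Preiss smallness ALREADY in `CondsL` discharge the zero-freeness hypothesis of
# `B13LocEAnalytic` (p250726); what is left of S4 is the holomorphy of the ACTIVITIES H(Z; ·) along the seam.
# (XREAD X18 junction certificate of b2b-balaban-beta-d4-p3 gen 17 on the row-D4 OWNER's p250726; filed by gen 18 on the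
# OWNER's scoped GO (journal CLAIMS.log l.28119) at the owner's preferred Literature target (l.28166), so that the
# Literature-side row-D4 adapter can import `hdiff_of_activities` by name.)

Sources: [I] T. Bałaban, *Renormalization group approach to lattice gauge field theories. I*, Commun. Math. Phys. 109
(1987) 249–301 — (4.4) p. 281 (the configuration seam); [II] T. Bałaban, *… II. Cluster expansions*, Commun. Math. Phys.
116 (1988) 1–22 — p. 15 (analyticity of the activities and of E^{(k+1)}(X)), Lemma 3 (2.38) p. 20; [KP86] R. Kotecký,
D. Preiss, *Cluster expansion for abstract polymer models*, Commun. Math. Phys. 103 (1986) 491–498.  What is reproduced: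
the two sentences of [II] quoted below, as one implication over the tree's typed objects (no estimate of the series).
Cell pub-balaban, β sub-cell, BINDER row D4, ROAD P3 (co-owner #3).  [II] p. 15: *"Thus the activities in (2.13), and
the whole sum E^{(k+1)}(X), are analytic functions of (𝐔, 𝐉), on the space 𝐔ᶜ_{k+1}(X, α₀, α₁)"*; p. 20 (after (2.38)):
*"The above lemma implies that sufficient conditions for convergence of the series (2.12), (2.13) are satisfied"*.
The owner's `B13Resummation.differentiableOn_locE_param_of_kp` (p250726) types the first sentence with the Kotecký–Preiss
condition on ALL domains as a HYPOTHESIS (`hKP`).  On road P3 the activities are read along the (4.4)-seam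
`emb X : Wn → Φ` into `𝐔ᶜ_{k+1}(X, α₀, α₁)`; there (2.38) bounds `H(Z, emb X v)` only for the polymers `Z ⊂ X`
(restriction property p. 15), which is all (2.13) reads (`locE_congr`).  Truncating the activities to `Z ⊂ X`, the
printed second sentence becomes `B13Resummation.kp_condition` with τ = C₃ε₁e^{5κ+1}K₀ν (the choice of
`norm_locE_le_of_small`), under EXACTLY the largeness/smallness fields `CondsL.large` / `CondsL.small` that road P3's ENDs
already carry.  Hence: **S4 `hdiff` at (n, X) ⇐ S1 `W`, S2 `hsp`, S3 `hrep`, `h238`, S5 `emb`/`hemb`, `hcomp`, `CondsL`,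
`0 ≤ C₃ε₁`, and ONE datum — `DifferentiableOn ℂ (fun v => H(Z, emb X v)) (ball 0 α₂)` for the polymers `Z ⊂ X`** — no
zero-freeness socket, no `AnalyticOnNhd`, no Osgood/Hartogs.
HONEST FRAMING: [folklore]-level bookkeeping over the tree's Kotecký–Preiss objects; nothing of Bałaban's estimates is
asserted or proved; (D4) NOT discharged; row D4 class UNCHANGED; NOT BetaPertH, NOT continuum, NOT Clay.
HONEST DEPENDENCY: continuum YM on T⁴ ⇐ BetaPertH ∧ nine spine estimates (0/9 proved); BetaPertH ⇐ (D1) ∧ (D4) ∧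
CAP+tail; G-an2-4 gates asym, D1 and NE2/3/4.
-/

noncomputable section

open Metric Filter Topology Set

namespace Literature.MathematicalPhysics.QuantumFieldTheory.Balaban1983to89.Beta.RemainderSeamHolo

open Literature.Probability.LatticeModels
open Literature.MathematicalPhysics.QuantumFieldTheory.Balaban1983to89
open Literature.MathematicalPhysics.QuantumFieldTheory.Balaban1983to89.B13
open Literature.MathematicalPhysics.QuantumFieldTheory.Balaban1983to89.B13FamilySum
open Literature.MathematicalPhysics.QuantumFieldTheory.Balaban1983to89.B13Resummation
open Literature.MathematicalPhysics.QuantumFieldTheory.Balaban1983to89.TreeLengthTorus (TDom tsys)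
open Literature.MathematicalPhysics.QuantumFieldTheory.Balaban1983to89.TreeLengthTorusGeometry (TorusStep)
open Literature.MathematicalPhysics.QuantumFieldTheory.Balaban1983to89.Beta.RemainderChainLattice (CondsL)

/-! ## 1. The Kotecký–Preiss volume from a GLOBAL (2.38)-shape bound (= `kp_condition`, packaged as `IsKPVolume`) -/

/-- **[KP86] hypothesis (1) as `IsKPVolume`** from a (2.38)-shape bound on ALL polymers: the content of
`B13Resummation.kp_condition` followed by `kp_hypothesis_of_fintype` / `isKPVolume_of_tsum_le` (the three lines of
`B13Resummation.exp_sum_locE_eq_Z`), with a(Z) = τ·#cubes Z.  [II] p. 20: *"The above lemma implies that sufficient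
conditions for convergence of the series (2.12), (2.13) are satisfied"*. [cite: Balaban1988RG2Cluster, p.20 (after (2.38))] -/
theorem isKPVolume_of_bound {Dom Cube : Type*} [DecidableEq Dom] [DecidableEq Cube] [Fintype Dom]
    (ι : Dom → Dom → Prop) [DecidableRel ι] {cubes reach : Dom → Finset Cube} {d : Dom → ℝ} {w : Dom → ℂ}
    {A R κ₀ K₀ c₁ τ s b ν : ℝ}
    (hloc : ∀ Z Z', ι Z' Z → ∃ q ∈ reach Z, q ∈ cubes Z')
    (hreach : ∀ Z, ((reach Z).card : ℝ) ≤ ν * (cubes Z).card)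
    (hd : ∀ Z, 0 ≤ d Z) (hA : 0 ≤ A) (hK₀ : 0 ≤ K₀) (hτ : 0 ≤ τ) (hs : 0 ≤ s) (hb : 0 ≤ b)
    (hw : ∀ Z, ‖w Z‖ ≤ A * Real.exp (-(R * d Z)))
    (h126 : Ineq126 (Finset.univ : Finset Dom) cubes d κ₀ K₀)
    (hvol : VolBound (Finset.univ : Finset Dom) cubes d c₁)
    (hrate : κ₀ + s + τ * c₁ ≤ R) (hsmall : A * Real.exp (b + τ * c₁) * K₀ * ν ≤ τ) :
    IsKPVolume ι w (fun Z => τ * ((cubes Z).card : ℝ)) (Finset.univ : Finset Dom) := by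
  have hkp := kp_condition ι hloc hreach hd hA hK₀ hτ hw h126 hvol hrate hsmall
  have h1 := fun γ => kp_hypothesis_of_fintype (inc := ι) (w := w)
    (a := fun Z => τ * ((cubes Z).card : ℝ)) (d := fun Z => s * d Z + b) hkp γ
  have hdK : ∀ Z, 0 ≤ s * d Z + b := fun Z => add_nonneg (mul_nonneg hs (hd Z)) hb
  exact isKPVolume_of_tsum_le (inc := ι) (w := w) (a := fun Z => τ * ((cubes Z).card : ℝ))
    (d := fun Z => s * d Z + b) hdK h1 Finset.univ

/-! ## 2. E^{(k+1)}(X) ∘ (seam) is complex-differentiable when the activities are — abstract step data -/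

open Classical in
/-- **[II] p. 15 IN THE KERNEL, zero-freeness DISCHARGED by Lemma 3**: for step data `S` with constants `c`, the polymer
geometry `G` of 𝐃_{k+1}, the restriction property of the spaces (p. 15), the representation (2.13), Lemma 3's bound
(2.38)_ℓ, *"κ sufficiently large"* := `κ + 2κ₀ + 2 ≤ (1 − 8δ)ℓκ` and *"ε₁ sufficiently small"* :=
`C₃ε₁e^{5κ+1}K₀νc₁ ≤ 1` (the hypotheses of `RemainderChainKP.h118_linear_of_KP`, minus `R22gen`/`A₂`): if a seam
`emb : W → Φ` maps the α₂-ball into `𝐔ᶜ_{k+1}(X, α₀, α₁)` and the ACTIVITIES `v ↦ H(Z, emb v)` of the polymers `Z ⊂ X` are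
complex-differentiable on the ball, then so is `v ↦ E^{(k+1)}(X, emb v)`.  Proof: truncate the activities to `Z ⊂ X`
(`locE_congr`), get the Kotecký–Preiss condition for every `v` from (2.38) (`isKPVolume_of_bound`, τ = C₃ε₁e^{5κ+1}K₀ν),
apply `differentiableOn_locE_param_of_kp` (p250726). [cite: Balaban1988RG2Cluster, p.15 and p.20 (after (2.38))] -/
theorem differentiableOn_Ek1_seam_of_bound238 (S : B13.StepData) (c : B13.Consts) (ℓ : ℝ) {Cube : Type}
    [DecidableEq Cube] (G : Geometry S.Dk1 Cube) (hsp : SpRestr S G) (hrep : Repr213 S G)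
    (h238 : B13.Bound238With S c ℓ) (hA : 0 ≤ c.C3act * c.ε₁) (hκ : 0 ≤ c.κ)
    (hlarge : c.κ + 2 * G.κ₀ + 2 ≤ (1 - 8 * c.δ) * ℓ * c.κ)
    (hsmall : c.C3act * c.ε₁ * Real.exp (5 * c.κ + 1) * G.K₀ * G.ν * G.c₁ ≤ 1)
    {W : Type*} [NormedAddCommGroup W] [NormedSpace ℂ W] (X : S.Dk1.Dom) (emb : W → S.Φ) {α₂ : ℝ}
    (hemb : ∀ v ∈ ball (0 : W) α₂, emb v ∈ S.sp2 X)
    (hH : ∀ Z, G.cubes Z ⊆ G.cubes X → DifferentiableOn ℂ (fun v => S.H Z (emb v)) (ball 0 α₂)) :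
    DifferentiableOn ℂ (fun v => S.Ek1 X (emb v)) (ball 0 α₂) := by
  haveI : Std.Refl G.ι := ⟨G.ι_refl⟩
  haveI : Std.Symm G.ι := ⟨G.ι_symm⟩
  -- the X-truncated activities along the seam
  set H' : W → S.Dk1.Dom → ℂ := fun v Z => if G.cubes Z ⊆ G.cubes X then S.H Z (emb v) else 0 with hH'_def
  -- (2.13) on the seam reads only the activities of the polymers inside X
  have hEq : ∀ v ∈ ball (0 : W) α₂, S.Ek1 X (emb v) = locE G.ι G.cubes (H' v) (G.cubes X) := by
    intro v hv
    rw [hrep X (emb v) (hemb v hv)]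
    exact locE_congr G.ι fun Z hZ => by simp only [hH'_def, if_pos hZ]
  -- each truncated activity is complex-differentiable along the seam
  have hH' : ∀ Z, DifferentiableOn ℂ (fun v => H' v Z) (ball 0 α₂) := by
    intro Z
    by_cases hZ : G.cubes Z ⊆ G.cubes X
    · simp only [hH'_def, if_pos hZ]; exact hH Z hZ
    · simp only [hH'_def, if_neg hZ]; exact differentiableOn_const 0
  -- the truncated activities obey the (2.38)-shape bound GLOBALLY (restriction property p. 15 inside X, 0 outside)
  have hw : ∀ v ∈ ball (0 : W) α₂, ∀ Z, ‖H' v Z‖ ≤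
      c.C3act * c.ε₁ * Real.exp (-((1 - 8 * c.δ) * ℓ * c.κ * S.Dk1.dj Z)) := by
    intro v hv Z
    by_cases hZ : G.cubes Z ⊆ G.cubes X
    · simp only [hH'_def, if_pos hZ]
      exact h238 Z (emb v) (hsp X Z (emb v) hZ (hemb v hv))
    · simp only [hH'_def, if_neg hZ, norm_zero]
      exact mul_nonneg hA (Real.exp_nonneg _)
  -- the Kotecký–Preiss condition for every seam parameter, τ = C₃ε₁e^{5κ+1}K₀ν as in `norm_locE_le_of_small`
  set τ : ℝ := c.C3act * c.ε₁ * Real.exp (5 * c.κ + 1) * G.K₀ * G.ν with hτ_def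
  have hτ : 0 ≤ τ := mul_nonneg (mul_nonneg (mul_nonneg hA (Real.exp_nonneg _)) G.K₀_nonneg) G.ν_nonneg
  have hτc : τ * G.c₁ ≤ 1 := hsmall
  have hsmall' : c.C3act * c.ε₁ * Real.exp (5 * c.κ + τ * G.c₁) * G.K₀ * G.ν ≤ τ := by
    have hexp : Real.exp (5 * c.κ + τ * G.c₁) ≤ Real.exp (5 * c.κ + 1) := Real.exp_le_exp.2 (by linarith)
    calc c.C3act * c.ε₁ * Real.exp (5 * c.κ + τ * G.c₁) * G.K₀ * G.ν
        ≤ c.C3act * c.ε₁ * Real.exp (5 * c.κ + 1) * G.K₀ * G.ν := by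
          have := G.K₀_nonneg; have := G.ν_nonneg; gcongr
      _ = τ := rfl
  have hrate : G.κ₀ + 0 + τ * G.c₁ ≤ (1 - 8 * c.δ) * ℓ * c.κ := by
    have := G.κ₀_nonneg; linarith
  have hKP : ∀ v ∈ ball (0 : W) α₂,
      IsKPVolume G.ι (H' v) (fun Z => τ * ((G.cubes Z).card : ℝ)) Finset.univ := fun v hv =>
    isKPVolume_of_bound G.ι (R := (1 - 8 * c.δ) * ℓ * c.κ) (s := 0) (b := 5 * c.κ) G.loc G.reach_le
      S.Dk1.dj_nonneg hA G.K₀_nonneg hτ le_rfl (by linarith) (fun Z => by simpa [mul_assoc] using hw v hv Z)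
      G.ineq126 G.volBound hrate hsmall'
  -- [KP86] zero-free rays ⇒ holomorphy of the localized cluster sum in the seam parameter (p250726)
  have hdiff : DifferentiableOn ℂ (fun v => locE G.ι G.cubes (H' v) (G.cubes X)) (ball 0 α₂) :=
    differentiableOn_locE_param_of_kp G.ι G.cubes (G.cubes X) isOpen_ball hH' hKP
  exact hdiff.congr hEq

open Classical in
/-- The same for a NAMED pull-back `EX = E^{(k+1)}(X) ∘ emb` (road P3's `hcomp`): `EX` is complex-differentiable on the
α₂-ball — the literal shape of the row-D4 leaf `hdiff` (`RemainderLimitTorusHolo.PolLeavesTLocH.hdiff`,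
`RemainderLocalityHolo.PolLeavesTFacH.hdiff`, road P3's `ResidualH.hdiff`) at one (torus, domain).
[cite: Balaban1987RG1, (4.4) p.281; Balaban1988RG2Cluster, p.15] -/
theorem differentiableOn_seam_of_bound238 (S : B13.StepData) (c : B13.Consts) (ℓ : ℝ) {Cube : Type}
    [DecidableEq Cube] (G : Geometry S.Dk1 Cube) (hsp : SpRestr S G) (hrep : Repr213 S G)
    (h238 : B13.Bound238With S c ℓ) (hA : 0 ≤ c.C3act * c.ε₁) (hκ : 0 ≤ c.κ)
    (hlarge : c.κ + 2 * G.κ₀ + 2 ≤ (1 - 8 * c.δ) * ℓ * c.κ)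
    (hsmall : c.C3act * c.ε₁ * Real.exp (5 * c.κ + 1) * G.K₀ * G.ν * G.c₁ ≤ 1)
    {W : Type*} [NormedAddCommGroup W] [NormedSpace ℂ W] (X : S.Dk1.Dom) (emb : W → S.Φ) (EX : W → ℂ)
    {α₂ : ℝ} (hemb : ∀ v ∈ ball (0 : W) α₂, emb v ∈ S.sp2 X) (hcomp : ∀ v, EX v = S.Ek1 X (emb v))
    (hH : ∀ Z, G.cubes Z ⊆ G.cubes X → DifferentiableOn ℂ (fun v => S.H Z (emb v)) (ball 0 α₂)) :
    DifferentiableOn ℂ EX (ball 0 α₂) :=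
  (differentiableOn_Ek1_seam_of_bound238 S c ℓ G hsp hrep h238 hA hκ hlarge hsmall X emb hemb hH).congr
    fun v _ => hcomp v

/-! ## 3. Torus step data under `CondsL`: road P3's socket S4 at (n, X) from the activities -/

open Classical in
/-- **ROAD P3 / row D4, socket S4 FROM THE ACTIVITIES.**  For torus step data `W` (road P3's S1) with the restriction
property (S2), the representation (2.13) (S3) and Lemma 3 (2.38)_ℓ (`h238`), under the cell's `CondsL d c ℓ` and
`0 ≤ C₃ε₁` (both already hypotheses of every road-P3 END), a seam `emb` into `𝐔ᶜ_{k+1}(X, α₀, α₁)` on the α₂-ball (S5)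
and the pull-back `EX = E^{(k+1)}(X) ∘ emb` (`hcomp`): IF the activities `v ↦ H(Z, emb v)` of the polymers `Z ⊂ X` are
complex-differentiable on the ball, THEN `DifferentiableOn ℂ EX (ball 0 α₂)` — the field `hdiff n X` of
`PolLeavesTLocH`/`PolLeavesTFacH`/`ResidualH`.  Nothing else is consumed: the zero-freeness of p250726 is paid by
(2.38) + `CondsL.large`/`CondsL.small`. [cite: Balaban1987RG1, (4.4) p.281; Balaban1988RG2Cluster, p.15 and (2.38) p.20] -/
theorem hdiff_of_activities {d N : ℕ} [NeZero N] (W : TorusStep d N) {c : B13.Consts} {ℓ : ℝ}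
    (hsp : SpRestr W.toStepData W.geom) (hrep : Repr213 W.toStepData W.geom)
    (h238 : B13.Bound238With W.toStepData c ℓ) (hC : CondsL d c ℓ) (hA : 0 ≤ c.C3act * c.ε₁)
    {Wn : Type*} [NormedAddCommGroup Wn] [NormedSpace ℂ Wn] (X : TDom d N) (emb : Wn → W.Φ) (EX : Wn → ℂ)
    {α₂ : ℝ} (hemb : ∀ v ∈ ball (0 : Wn) α₂, emb v ∈ W.sp2 X) (hcomp : ∀ v, EX v = W.Ek1 X (emb v))
    (hH : ∀ Z : TDom d N, Z.1 ⊆ X.1 → DifferentiableOn ℂ (fun v => W.H Z (emb v)) (ball 0 α₂)) :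
    DifferentiableOn ℂ EX (ball 0 α₂) :=
  differentiableOn_seam_of_bound238 W.toStepData c ℓ W.geom hsp hrep h238 hA hC.kappa_pos.le hC.large hC.small
    X emb EX hemb hcomp fun Z hZ => hH Z hZ

open Classical in
/-- The family form over all domains of one torus: the literal shape `∀ X, DifferentiableOn ℂ (EXn X) (ball 0 α₂)` of
the row-D4 leaf `hdiff n` from `∀ X Z, Z ⊂ X → DifferentiableOn ℂ (v ↦ H(Z, emb X v)) (ball 0 α₂)`.
[cite: Balaban1987RG1, (4.4) p.281; Balaban1988RG2Cluster, p.15] -/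
theorem hdiff_family_of_activities {d N : ℕ} [NeZero N] (W : TorusStep d N) {c : B13.Consts} {ℓ : ℝ}
    (hsp : SpRestr W.toStepData W.geom) (hrep : Repr213 W.toStepData W.geom)
    (h238 : B13.Bound238With W.toStepData c ℓ) (hC : CondsL d c ℓ) (hA : 0 ≤ c.C3act * c.ε₁)
    {Wn : Type*} [NormedAddCommGroup Wn] [NormedSpace ℂ Wn] (emb : TDom d N → Wn → W.Φ)
    (EXn : TDom d N → Wn → ℂ) {α₂ : ℝ} (hemb : ∀ X, ∀ v ∈ ball (0 : Wn) α₂, emb X v ∈ W.sp2 X)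
    (hcomp : ∀ X v, EXn X v = W.Ek1 X (emb X v))
    (hH : ∀ X Z : TDom d N, Z.1 ⊆ X.1 → DifferentiableOn ℂ (fun v => W.H Z (emb X v)) (ball 0 α₂)) :
    ∀ X, DifferentiableOn ℂ (EXn X) (ball 0 α₂) := fun X =>
  hdiff_of_activities W hsp hrep h238 hC hA X (emb X) (EXn X) (hemb X) (hcomp X) (hH X)

end Literature.MathematicalPhysics.QuantumFieldTheory.Balaban1983to89.Beta.RemainderSeamHolo

end
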